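import Literature.AnabelianGeometry.AbsoluteAnabelian.ArithmeticLineBundlesProofs
import Mathlib.Analysis.Complex.Cardinality
import Mathlib.RingTheory.Localization.FractionRing
import Mathlib.Algebra.MvPolynomial.CommRing
import Mathlib.Tactic.LinearCombination
import HarnessLib

/-!
# [AbsTopIII] Def 5.3 (iii): `AddLineBundleAutIsRootOfUnity` AS TYPED (every field `F`) is false —
# the number-field hypothesis of `AddLineBundleAutIsRootOfUnity_holds` is NOT idle

S. Mochizuki, *Topics in absolute anabelian geometry III: global reconstruction algorithms*, J. Math.
Sci. Univ. Tokyo **22** (2015), §5, Definition 5.3 (iii) p. 124: "the automorphism group of any object of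
`Th⊚⊡_T[M⊚]` is naturally isomorphic to the finite abelian group `μ_{ℚ/ℤ}(M⊚_{TLG})^{Aut(Π)}`" — in the
tree: every automorphism of a `⊞`-line bundle is multiplication by a root of unity of `𝒪_F`
[cite: MochizukiAbsTopIII2015, Def 5.3 (iii) p. 124].  In print `F` is a NUMBER FIELD throughout §5.

PROOF-ONLY companion (no definitions) of `ArithmeticLineBundles.lean` (seat abc-iut-L4); cell abc-iut,
block F, seat abc-iut-f-045.  FACT-LIST row **F-0066**.  The decl
`AddLineBundleAutIsRootOfUnity : (F : Type) → [Field F] → Prop` carries NO `[NumberField F]` binder (the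
section's instance variable is not used by its body), whereas the discharge
`AddLineBundleAutIsRootOfUnity_holds (F) [Field F] [NumberField F]` (p407027; Kronecker's theorem) does —
two cell readings disagreed on whether that is the exact closure (abc-iut-w4-d032 02:59Z «PROVED»;
abc-iut-w5-d199 R7 v2 «[binders 3 vs 2; Prop-hyps: NumberField]»).  Kernel answer: the universal closure
over ALL fields is FALSE, i.e. the number-field hypothesis is genuinely used:
* `not_addLineBundleAutIsRootOfUnity_of_isEmpty_infinitePlace` — if `F` has NO archimedean place, the
  contraction clause of a `⊞`-morphism is vacuous, so any unit `u ∈ 𝒪_F^×` acts as an automorphism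
  (inverse `u⁻¹`) of the trivial `⊞`-line bundle; if `u` has infinite order the statement fails;
* `not_forall_addLineBundleAutIsRootOfUnity` — such a field exists: `F = Frac(ℝ[X_s : s ∈ 𝒫(ℝ)])` has
  cardinality `> 𝔠 = #ℂ`, hence no ring morphism to `ℂ` (no `InfinitePlace`), and contains the unit
  `1 + √2` (inverse `√2 − 1`, both integral over `ℤ`) of infinite order (`1 + √2 > 1` in `ℝ`).
Instance form of record (what consumers bind): `AddLineBundleAutIsRootOfUnity_holds` for number fields.  So
the row is admissible AT NAMED INSTANCES ONLY (R5).  Refuted-closure ≠ refuted-paper; a FACT row is an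
assumption label, not an endorsement; nothing here bears on [IUTchIII] Cor. 3.12.
-/

noncomputable section

open NumberField

namespace Literature.AnabelianGeometry.AbsoluteAnabelian

/-- **No archimedean place ⇒ units of infinite order are automorphisms.**  If `F` has no `InfinitePlace`
(no ring morphism `F → ℂ`), the contraction clause `norm_le` of a `⊞`-morphism is vacuous; multiplication by
a unit `u ∈ 𝒪_F^×` of infinite order (with inverse `u⁻¹`) is then an automorphism of the trivial `⊞`-line
bundle `𝒪_F` that is not a root of unity, so `AddLineBundleAutIsRootOfUnity F` fails.
[cite: MochizukiAbsTopIII2015, Def 5.3 (iii) p. 124] -/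
theorem not_addLineBundleAutIsRootOfUnity_of_isEmpty_infinitePlace {F : Type} [Field F]
    [IsEmpty (InfinitePlace F)] (u : (𝓞 F)ˣ) (hu : ¬ IsOfFinOrder u) :
    ¬ AddLineBundleAutIsRootOfUnity F := by
  intro h
  -- multiplication by a nonzero `c ∈ 𝒪_F` is an endomorphism of the trivial bundle (no place to check)
  have mk : ∀ c : 𝓞 F, c ≠ 0 → ∃ f : AddLineBundle.Hom (AddLineBundle.trivial F) (AddLineBundle.trivial F),
      f.toLinearMap = c • LinearMap.id := fun c hc =>
    ⟨{ toLinearMap := c • LinearMap.id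
       ne_zero := fun h0 => hc (by
         have h1 := LinearMap.congr_fun h0 (1 : 𝓞 F)
         change c * 1 = 0 at h1
         rwa [mul_one] at h1)
       norm_le := fun v => isEmptyElim v }, rfl⟩
  obtain ⟨f, hf⟩ := mk (u : 𝓞 F) u.ne_zero
  obtain ⟨g, hg⟩ := mk (↑u⁻¹ : 𝓞 F) u⁻¹.ne_zero
  have hfg : f.toLinearMap.comp g.toLinearMap = LinearMap.id := by
    rw [hf, hg, LinearMap.smul_comp, LinearMap.comp_smul, LinearMap.id_comp, smul_smul, Units.mul_inv,
      one_smul]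
  have hgf : g.toLinearMap.comp f.toLinearMap = LinearMap.id := by
    rw [hf, hg, LinearMap.smul_comp, LinearMap.comp_smul, LinearMap.id_comp, smul_smul, Units.inv_mul,
      one_smul]
  obtain ⟨u', hu', hfu'⟩ := h (AddLineBundle.trivial F) f g hfg hgf
  -- `u • id = u' • id` forces `u = u'`
  have huu' : u = u' := by
    refine Units.ext ?_
    have h1 := LinearMap.congr_fun (hf.symm.trans hfu') (1 : 𝓞 F)
    change (u : 𝓞 F) * 1 = (u' : 𝓞 F) * 1 at h1
    rwa [mul_one, mul_one] at h1
  exact hu (huu' ▸ hu')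

/-- **F-0066, universal closure REFUTED.**  `F := Frac(ℝ[X_s : s ∈ 𝒫(ℝ)])` (a field of cardinality `> 𝔠`):
(a) any `InfinitePlace F` would give an injection `𝒫(ℝ) ↪ F ↪ ℂ`, contradicting Cantor (`#ℂ = 𝔠 < 2^𝔠`);
(b) `u := 1 + √2 ∈ 𝒪_F` (integral over `ℤ`, inverse `√2 − 1`) has infinite order since `(1 + √2)^n > 1`
in `ℝ ↪ F`.  Hence `¬ ∀ F, AddLineBundleAutIsRootOfUnity F`; instance form of record:
`AddLineBundleAutIsRootOfUnity_holds` (number fields). [cite: MochizukiAbsTopIII2015, Def 5.3 (iii) p. 124] -/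
theorem not_forall_addLineBundleAutIsRootOfUnity :
    ¬ ∀ (F : Type) [Field F], AddLineBundleAutIsRootOfUnity F := by
  intro h
  -- (a) no archimedean place, by cardinality
  haveI : IsEmpty (InfinitePlace (FractionRing (MvPolynomial (Set ℝ) ℝ))) := by
    refine ⟨fun w => ?_⟩
    have hinj : Function.Injective fun s : Set ℝ =>
        w.embedding (algebraMap (MvPolynomial (Set ℝ) ℝ) (FractionRing (MvPolynomial (Set ℝ) ℝ))
          (MvPolynomial.X s)) :=
      w.embedding.injective.comp
        ((IsFractionRing.injective (MvPolynomial (Set ℝ) ℝ) (FractionRing (MvPolynomial (Set ℝ) ℝ))).comp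
          (MvPolynomial.X_injective (R := ℝ)))
    have hle := Cardinal.mk_le_of_injective hinj
    rw [Cardinal.mk_set, Cardinal.mk_real, Cardinal.mk_complex] at hle
    exact (not_le.mpr (Cardinal.cantor Cardinal.continuum)) hle
  -- (b) the unit `1 + √2`
  let ι : ℝ →+* FractionRing (MvPolynomial (Set ℝ) ℝ) :=
    (algebraMap (MvPolynomial (Set ℝ) ℝ) (FractionRing (MvPolynomial (Set ℝ) ℝ))).comp MvPolynomial.C
  have hι : Function.Injective ι :=
    (IsFractionRing.injective (MvPolynomial (Set ℝ) ℝ) (FractionRing (MvPolynomial (Set ℝ) ℝ))).comp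
      (MvPolynomial.C_injective _ _)
  have hsq : Real.sqrt 2 * Real.sqrt 2 = 2 := Real.mul_self_sqrt (by norm_num)
  have h2 : IsIntegral ℤ (Real.sqrt 2) := by
    refine IsIntegral.of_pow two_pos ?_
    rw [pow_two, hsq]
    simpa using isIntegral_algebraMap (R := ℤ) (A := ℝ) (x := 2)
  -- the real algebraic integers `1 + √2`, `√2 - 1` (mutually inverse) and their images in `𝒪_F`
  let a₀ : 𝓞 ℝ := ⟨1 + Real.sqrt 2, isIntegral_one.add h2⟩
  let b₀ : 𝓞 ℝ := ⟨Real.sqrt 2 - 1, h2.sub isIntegral_one⟩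
  have hab₀ : a₀ * b₀ = 1 := by
    refine RingOfIntegers.ext ?_
    show (1 + Real.sqrt 2) * (Real.sqrt 2 - 1) = 1
    linear_combination hsq
  let φ : 𝓞 ℝ →+* 𝓞 (FractionRing (MvPolynomial (Set ℝ) ℝ)) := RingOfIntegers.mapRingHom ι
  let u : (𝓞 (FractionRing (MvPolynomial (Set ℝ) ℝ)))ˣ :=
    Units.map (φ : 𝓞 ℝ →* 𝓞 (FractionRing (MvPolynomial (Set ℝ) ℝ))) (Units.mkOfMulEqOne a₀ b₀ hab₀)
  have hu : ¬ IsOfFinOrder u := by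
    rw [isOfFinOrder_iff_pow_eq_one]
    rintro ⟨n, hn, hun⟩
    -- `(1 + √2)^n = 1` in `F`, hence in `ℝ`: impossible since `1 + √2 > 1`
    have h1 : ((φ a₀ : 𝓞 (FractionRing (MvPolynomial (Set ℝ) ℝ))) :
        FractionRing (MvPolynomial (Set ℝ) ℝ)) ^ n = 1 := by
      have := congrArg (fun x : (𝓞 (FractionRing (MvPolynomial (Set ℝ) ℝ)))ˣ =>
        ((x : 𝓞 (FractionRing (MvPolynomial (Set ℝ) ℝ))) : FractionRing (MvPolynomial (Set ℝ) ℝ))) hun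
      simpa [u, Units.val_pow_eq_pow_val] using this
    have h2' : ι ((1 + Real.sqrt 2) ^ n) = ι 1 := by
      rw [map_pow, map_one, ← h1]
      rfl
    have h3 : (1 + Real.sqrt 2) ^ n = 1 := hι h2'
    have hgt : (1 : ℝ) < 1 + Real.sqrt 2 := by
      have := Real.sqrt_pos.mpr (show (0:ℝ) < 2 by norm_num)
      linarith
    exact absurd h3 (one_lt_pow₀ hgt hn.ne').ne'
  exact not_addLineBundleAutIsRootOfUnity_of_isEmpty_infinitePlace u hu (h _)

end Literature.AnabelianGeometry.AbsoluteAnabelian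

end
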